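import Summits.Parity.GeneralizedHardyLittlewood.Theorems.PrimeLevelFamEdgeMomentsBeyondDiagonalDiagDecorCross
import Summits.Parity.GeneralizedHardyLittlewood.Theorems.PrimeLevelFamEdgeMomentsBeyondDiagonalDiagDecorPrimePowPeelMixed
import HarnessLib

/-!
# Route `PrimeLevelFamEdge`, crux K_A `MomentsBeyondDiagonal` (stmt-Parity-20007), line «petersson_layers» v4, stub `stub_diag`:
# **the GENERIC mixed family `P_{i+1}·P_{i′+1}` of decorated coprime Selberg sums:
# `Σ_{k≤y,(k,n)=1}τ(k)W(k)P_{i+1}(k)P_{i′+1}(k)logᶜ(y/k) = −(A_{i+i′+2} − 2·i!·(…)·A_{i′+1})·E_n·log^{c+i+i′}y + O(D(n)(1+κ(n))(1+log y)^{c+i+i′−1})`**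
# (`c ≥ 2`; `P_m(k) = Σ_{p∣k} log^m p`) — the pair bricks `P₂P₆`, `P₄²` of the `M₈`-engine of order `(4,4)`

`…DiagDecorPrimeSqPrimeFourth` (`P₂P₄ ↦ −216`) for arbitrary exponents: by the mixed double peel
`…DiagDecorPrimePowPeelMixed.sum_copTauW_mul_primePow_mul_primePow_eq` the sum is the `P_{i+i′+2}`-peel
(`…DiagDecorPrimePowTwo.abs_coprimeSumPow_primePow_add_le_of_two_le (i+1+i′)`) plus the cross term with outer weight `log^{i+1}p`
and inner decoration `P_{i′+1}` (`…DiagDecorCross.abs_decorCross_sub_le` over `…PrimePowTwo … i′`); the leading coefficient is left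
in the closed factorial form the two inputs deliver (no identity needed):

* `abs_coprimeSumPow_primePowPair_add_le` — **the displayed asymptotic**, every `i, i′`.

Instances for `M₈ = τ(105P₂⁴ − 420P₂²P₄ + 448P₂P₆ + 140P₄² − 272P₈)` (units `c!/(c+6)!·E_n log^{c+6}y`): `P₂P₆ ↦ −9600`
(`i = 1, i′ = 5`: `10080 − 2·1!·240`), `P₄² ↦ −9936` (`i = i′ = 3`: `10080 − 2·3!·12`); with `P₈ ↦ −10080`, `P₂²P₄ ↦ −9024`,
`P₂⁴ ↦ −8000` (triple/quadruple peels, next bricks) one gets `105·8000 − 420·9024 + 448·9600 + 140·9936 − 272·10080 = 0`: the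
`M₈`-decorated coprime sums have no `log^{c+6}` term. Def-free; theorems only. Helper `--supports stmt-Parity-20007`; closes
nothing; K_A, K_B and the Parity summit are NOT proved; nothing about Landau–Siegel zeros.

## References
* E. Kowalski, P. Michel, J. VanderKam, J. reine angew. Math. 526 (2000), (23)–(28) pp. 13–15 and Prop. 5.1 p. 18.
  [cite: KowalskiMichelVanderKam2000, (23)–(28) — derivation (prime-power-log decorations of the Selberg coordinates)]
-/

noncomputable section

open scoped Real
open Finset ArithmeticFunction

namespace Summit.Parity.GeneralizedHardyLittlewood.Theorems.MomentsBeyondDiagonal.DiagKernel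

open Literature.NumberTheory.LFunctions Literature.NumberTheory.LFunctions.KMV2000
open SelbergCoord (kappa)
open Summit.Parity.GeneralizedHardyLittlewood.Theorems.BeyondDiagonalBeatsQuarter.KernelFormXSq
  (copTauW mainConst divWeight divWeight_nonneg mainConst_nonneg)
open Summit.Parity.GeneralizedHardyLittlewood.Theorems.MomentsBeyondDiagonal.DiagLines
  (sum_copTauW_mul_mul_sum_primeFactors_eq sum_copTauW_mul_primePow_mul_primePow_eq)

/-- **The `P_{i+1}P_{i′+1}`-decorated coprime Selberg sum** (`c ≥ 2`, every `i, i′`): there is `C` with, for all `n ≥ 1`, `y ≥ 1`,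
`|Σ_{k≤y} a_n(k)·logᶜ(y/k)·P_{i+1}(k)P_{i′+1}(k) + (A − B)·E_n·log^{c+i+i′}y| ≤ C·D(n)(1+κ(n))(1+log y)^{c+i+i′−1}`, where
`A = 2c(c−1)(i+1+i′)!(c−2)!/(c+i+i′)!` is the `P_{i+i′+2}`-peel coefficient and `B = 2·(2c(c−1)i′!(c−2)!/(c+i′−1)!)·(i!(c+i′−1)!/(c+i+i′)!)`
the cross-term coefficient. [cite: KowalskiMichelVanderKam2000, (23)–(28) — derivation] -/
theorem abs_coprimeSumPow_primePowPair_add_le (i i' : ℕ) {c : ℕ} (hc : 2 ≤ c) :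
    ∃ C : ℝ, 0 < C ∧ ∀ n : ℕ, n ≠ 0 → ∀ y : ℝ, 1 ≤ y →
      |∑ k ∈ Icc 1 ⌊y⌋₊, copTauW n k * Real.log (y / k) ^ c *
          ((∑ p ∈ k.primeFactors, Real.log p ^ (i + 1)) * ∑ p ∈ k.primeFactors, Real.log p ^ (i' + 1)) +
          (2 * ((c : ℝ) * ((c : ℝ) - 1)) * (((i + 1 + i').factorial : ℝ) * (c - 2).factorial / (c + i + i').factorial) -
            2 * (2 * ((c : ℝ) * ((c : ℝ) - 1)) * ((i'.factorial : ℝ) * (c - 2).factorial / (c - 2 + i' + 1).factorial)) *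
              ((i.factorial : ℝ) * (c - 2 + i' + 1).factorial / (c + i + i').factorial)) *
            mainConst n * Real.log y ^ (c + i + i')| ≤
        C * divWeight n * (1 + kappa n) * (1 + Real.log y) ^ (c + i + i' - 1) := by
  obtain ⟨C₆, hC₆, h₆⟩ := abs_coprimeSumPow_primePow_add_le_of_two_le (i + 1 + i') hc
  obtain ⟨C₄, hC₄, h₄⟩ := abs_coprimeSumPow_primePow_add_le_of_two_le i' hc
  obtain ⟨C_X, hC_X, hX⟩ := abs_decorCross_sub_le (fun k : ℕ ↦ ∑ p ∈ k.primeFactors, Real.log p ^ (i' + 1)) i (c - 2 + i')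
    hC₄ h₄
  refine ⟨C₆ + C_X, by positivity, fun n hn y hy ↦ ?_⟩
  set N := ⌊y⌋₊ with hN
  have hP := h₆ n hn y hy
  have hXn := hX n hn y hy
  beta_reduce at hXn
  have e1 : c - 2 + (i + 1 + i') + 1 = c + i + i' := by omega
  have e1' : c - 2 + (i + 1 + i') = c + i + i' - 1 := by omega
  have e2 : c - 2 + i' + 1 + i + 1 = c + i + i' := by omega
  have e2' : c - 2 + i' + 1 + i = c + i + i' - 1 := by omega
  rw [e1, e1'] at hP
  rw [e2, e2'] at hXn
  -- decomposition `Σ aG·P_{i+1}P_{i'+1} = P_{i+i'+2}-peel + cross`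
  have hpeel := sum_copTauW_mul_mul_sum_primeFactors_eq n N (fun k : ℕ ↦ Real.log (y / k) ^ c)
    (fun p : ℕ ↦ Real.log p ^ (i + 1 + i' + 1))
  have hmix := sum_copTauW_mul_primePow_mul_primePow_eq n N (i + 1) (i' + 1) (fun k : ℕ ↦ Real.log (y / k) ^ c)
  beta_reduce at hpeel hmix
  rw [show i + 1 + (i' + 1) = i + 1 + i' + 1 by ring, ← hpeel] at hmix
  rw [hmix]
  -- regroup the main terms
  have key : ∀ {A X M₁ M₂ M : ℝ}, M₁ - M₂ = M → A + X + M = (A + M₁) + (X - M₂) := by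
    intro A X M₁ M₂ M h; rw [← h]; ring
  rw [key (M₁ := 2 * ((c : ℝ) * ((c : ℝ) - 1)) * (((i + 1 + i').factorial : ℝ) * (c - 2).factorial / (c + i + i').factorial) *
      mainConst n * Real.log y ^ (c + i + i'))
    (M₂ := 2 * (2 * ((c : ℝ) * ((c : ℝ) - 1)) * ((i'.factorial : ℝ) * (c - 2).factorial / (c - 2 + i' + 1).factorial)) *
      ((i.factorial : ℝ) * (c - 2 + i' + 1).factorial / (c + i + i').factorial) * mainConst n * Real.log y ^ (c + i + i'))
    (by ring)]
  refine ((abs_add_le _ _).trans (add_le_add hP hXn)).trans_eq ?_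
  ring

end Summit.Parity.GeneralizedHardyLittlewood.Theorems.MomentsBeyondDiagonal.DiagKernel

end
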